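import Summits.ABC.IUTFork.Joshi.DictionaryThetaLoci
import Summits.ABC.IUTFork.Joshi.TestThetaLociPinned
import Summits.ABC.IUTFork.Joshi.TestDictionaryFloor
import HarnessLib

/-!
# X-09 — TEST of the theta-values-loci dictionary rows (D-09 / D-11) at the FLOOR model and at the PINNED countermodel

Record file of the abc-iut cell, branch E (rung LADDER-ABC:A2.E; seat abc-iut-E-t22, slot T-53 = X-09 of plan/E/E-PLAN.md §6,
assigned by abc-iut-E-plan-2 2026-08-26T07:13:52Z: «`Joshi/TestThetaLoci.lean` deciding your D-09/D-11 candidate Props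
(`LocusInShellsJ` / `LocusInShellsM` and the Thm-Def 9.8.1.1 (4)/(7) dictionary Props) at (i) `PinnedWitness.pinnedSetting` p419720 and
(ii) the floor model `linkIdSetting` of p429619»). **No side is taken** on [IUTchIII] Cor. 3.12 or on any author; Joshi's papers
(arXiv:2401.13508v4 = [J-III]) are unrefereed preprints cited as such; typed ≠ proved; a model EXHIBITS (non-)satisfiability of
typed hypotheses, nothing more. R13: negative evaluations below are «J-FALSE-AT-PINNED» data, not COUNTERMODEL verdicts; R15: every
use of `StandardPointIsQPilot` carries E-ref's grade STRONGER-THAN-PRINT.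

THE OBJECT UNDER TEST. `Joshi/DictionaryThetaLoci.lean` (p429683) reads Joshi's tensor-packet locus `Θ̃^𝓘_Mochizuki`
([J-III] Thm-Def 9.8.1.1 (5)(6), typed in `Joshi/ThetaLociTensorPackets.lean` over the signature `ATS3.TensorPacketLociDatum`) in OUR
packets through a DATA-ONLY `LociReading` (row D-09 `proj`, row D-02 `pt`) and states the candidate rows `LocusWithinPossibleImages` /
`PossibleImagesWithinLocus` (print's «are Mochizuki's multi-radial representations», (7) p.116 l.43–50), `LocusWithinHull` (what
(xi-f) consumes), and OUR READINGS `StdDatumWithinLocus`, `GeneratorsReadAsData`; the signature rows `LocusInShellsJ/M` ((7) «⊂ Ĩ»).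

THE TEST MODELS (toy DATA, labelled DEGENERATE). §1 `regionLoci S Rgn`: for ANY lattice situation and ANY family of non-empty
packet regions `Rgn j vQ`, a loci signature with ONE place, ONE arithmeticoid, ONE Ansatz point, trivial classes and norms, the
INDISCRETE topology on the tuples of packet points (`WithTopology _ ⊤`), IDENTITY convex closures, and collation maps = the
constant maps onto the tuples lying in `∏ Rgn` — so that Joshi's locus, read back by the coordinate reading `regionReading`, IS
the prescribed region family (`locusRegion_regionReading`). Nothing of [J-III] §4/§5/§9.4's content is modelled (that is the
point of a floor, as in X-04-min p429619). §2 generic rows for `Rgn :=` the `ρ`-region of a move-free dictionary's datum.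
§3 THE FLOOR (`linkIdSetting p = expSetting p (1,4)`, `ρ = ballOfMonoid p`, `qK = Ψ`, Θ-reading): ALL loci rows, both concordance
readings, `LocusInShellsJ/M`, Y₁, Y₂, S and the typed Corollary 3.12 hold together — the D-11 chain of p429683 is SATISFIABLE
(non-vacuity), degenerate as labelled. §4 THE PINNED COUNTERMODEL (p419720, S false): the SPLIT — Θ-reading ⇒ every loci row incl.
both halves of «are» holds while Y₂ FAILS; q-reading ⇒ `StdDatumWithinLocus ∧ Y₂` hold while `LocusWithinHull` (hence
`LocusWithinPossibleImages`) FAILS (p430545's universal form instantiated). So at the model of record the loci rows separate from S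
exactly along the identification «standard datum = q-pilot datum» — LOCATED, not adjudicated.

REPORT (R9 grammar, for plan/E/cx/TEST-LEDGER.md X-09): «E TEST J3:ThmDef9.8.1.1: target=S: S-BYPASSED shape=Licence/SVB via
Y = LocusWithinHull ∧ StdDatumWithinLocus (+ StandardPointIsQPilot [R15] | StandardPointHasQPilotVolume) — STATEMENT-DIRECT p429683;
dict model = FLOOR (this file, DEGENERATE); J-FALSE-AT-PINNED p430545 + pinned split (this file); faithfulness: E-ref».
[claim: Joshi2024ATS3, status: disputed] [claim: Mochizuki2012, status: disputed]
-/

noncomputable section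

open Set

namespace Summit.ABC.IUTFork.Joshi

open Thm311 Cor312 Cor312Vol

/-! ## 0. Two facts about the indiscrete topology `WithTopology X ⊤` (toy carrier) -/

/-- Every subset of an indiscrete space is compact. [folklore] -/
theorem isCompact_withTopology_top {X : Type} (s : Set (WithTopology X ⊤)) : IsCompact s := by
  refine isCompact_of_finite_subcover fun {ι} U hU hsU => ?_
  by_cases hs : s = ∅
  · exact ⟨∅, by simp [hs]⟩
  obtain ⟨x, hx⟩ := Set.nonempty_iff_ne_empty.mpr hs
  obtain ⟨i, hi⟩ := Set.mem_iUnion.mp (hsU hx)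
  have hpre : WithTopology.toTopology ⊤ ⁻¹' U i = ∅ ∨ WithTopology.toTopology ⊤ ⁻¹' U i = univ :=
    (TopologicalSpace.isOpen_top_iff _).mp ((WithTopology.isOpen_iff ⊤).mp (hU i))
  have hUi : U i = univ := by
    rcases hpre with h | h
    · exact absurd (show WithTopology.ofTopology x ∈ WithTopology.toTopology ⊤ ⁻¹' U i by simpa using hi)
        (by rw [h]; exact Set.notMem_empty _)
    · refine Set.eq_univ_of_forall fun y => ?_
      have : WithTopology.ofTopology y ∈ WithTopology.toTopology ⊤ ⁻¹' U i := by rw [h]; exact Set.mem_univ _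
      simpa using this
  exact ⟨{i}, fun y _ => Set.mem_iUnion₂.mpr ⟨i, Finset.mem_singleton_self i, by rw [hUi]; exact Set.mem_univ _⟩⟩

/-- Every map into an indiscrete space is continuous. [folklore] -/
theorem continuous_into_withTopology_top {α X : Type} [TopologicalSpace α] (f : α → WithTopology X ⊤) : Continuous f := by
  refine continuous_def.mpr fun U hU => ?_
  rcases (TopologicalSpace.isOpen_top_iff _).mp ((WithTopology.isOpen_iff ⊤).mp hU) with h | h
  · have hU0 : U = ∅ := Set.eq_empty_of_forall_notMem fun y hy => by
      have : WithTopology.ofTopology y ∈ WithTopology.toTopology ⊤ ⁻¹' U := by simpa using hy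
      rw [h] at this; exact this
    rw [hU0, Set.preimage_empty]; exact isOpen_empty
  · have hU1 : U = univ := Set.eq_univ_of_forall fun y => by
      have : WithTopology.ofTopology y ∈ WithTopology.toTopology ⊤ ⁻¹' U := by rw [h]; exact Set.mem_univ _
      simpa using this
    rw [hU1, Set.preimage_univ]; exact isOpen_univ

/-! ## 1. The region loci signature over any lattice situation (toy DATA) -/

section Region

variable {T : ThetaIndex} (S : LatticeSituation T)

/-- Tuples of packet points `(t_{j,v_ℚ})`, with the INDISCRETE topology (toy). [folklore] -/
abbrev TuplesTop : Type := WithTopology (∀ (j : T.Label) (vQ : T.VQ), S.L.Packet j vQ) ⊤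

variable (Rgn : ∀ (j : T.Label) (vQ : T.VQ), Set (S.L.Packet j vQ))

/-- The tuples all of whose coordinates lie in the prescribed regions (`∏_{j,v_ℚ} Rgn j vQ`). [folklore] -/
def regionTuples : Set (TuplesTop S) := {t | ∀ (j : T.Label) (vQ : T.VQ), t.ofTopology j vQ ∈ Rgn j vQ}

variable (hne : ∀ (j : T.Label) (vQ : T.VQ), (Rgn j vQ).Nonempty)

/-- A chosen tuple in `∏ Rgn` (non-emptiness). [folklore] -/
def someTuple : TuplesTop S := WithTopology.toTopology ⊤ fun j vQ => (hne j vQ).some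

/-- The chosen tuple lies in `∏ Rgn`. [folklore] -/
theorem someTuple_mem : someTuple S Rgn hne ∈ regionTuples S Rgn := fun j vQ => (hne j vQ).some_mem

/-- **The region loci signature** (toy DATA, DEGENERATE by design): `ℓ* := T.lstar`; ONE place, no odd-semistable place recorded;
ONE arithmeticoid = the standard one; ONE Ansatz point = the standard point; trivial class carriers (`PUnit`) with all norms `1`;
the standard coordinate space = tuples of packet points with the indiscrete topology, shell = everything (compact); collation maps
at `(y, w)` = the CONSTANT maps onto tuples in `∏ Rgn` (they exist: `hne`); identity «convex closures»; comparison maps = a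
coordinate; tensor norms `0`. It models none of [J-III] §4, §5, §9.4 — like the floor dictionary of p429619 it only makes the
typed rows evaluable. [folklore] -/
def regionLoci : ATS3.TensorPacketLociDatum PUnit (fun _ => TuplesTop S) (TuplesTop S) (TuplesTop S) where
  lstar := T.lstar
  Wss := ∅
  Y := PUnit
  y₀ := PUnit.unit
  Z := PUnit
  ext := fun _ _ => PUnit.unit
  zTheta := PUnit.unit
  zTheta_last := rfl
  sym := ∅
  H := fun _ _ => PUnit
  xi := fun _ _ => PUnit.unit
  one := fun _ _ => PUnit.unit
  nrm := fun _ _ _ => 1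
  shell := fun _ => univ
  shell_compact := fun _ => isCompact_withTopology_top _
  coll := fun _ _ => {ι | ∃ t ∈ regionTuples S Rgn, ι = fun _ => t}
  coll_nonempty := fun _ _ => ⟨fun _ => someTuple S Rgn hne, someTuple S Rgn hne, someTuple_mem S Rgn hne, rfl⟩
  coll_mem := fun _ _ _ _ _ => mem_univ _
  convJ := ClosureOperator.id _
  convM := ClosureOperator.id _
  toTensorJ := fun x => x ⟨0, by have := T.two_le_lstar; omega⟩ PUnit.unit
  toTensorJ_continuous := continuous_into_withTopology_top _
  toTensorM := fun x => x ⟨0, by have := T.two_le_lstar; omega⟩ (Fin.last _) PUnit.unit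
  toTensorM_continuous := continuous_into_withTopology_top _
  tensorMJ := id
  tnrmJ := fun _ => 0
  tnrmJ_continuous := continuous_const
  tnrmM := fun _ => 0
  tnrmM_continuous := continuous_const

/-- In the region signature `Ψ^{Mochizuki}` is the set of tuples all of whose entries lie in `∏ Rgn`. [folklore] -/
theorem mem_psiM_regionLoci (x : (regionLoci S Rgn hne).ProdM) :
    x ∈ (regionLoci S Rgn hne).psiM ↔ ∀ i a w, x i a w ∈ regionTuples S Rgn := by
  constructor
  · rintro ⟨_, hz⟩ i a w
    obtain ⟨ι, ⟨t, ht, rfl⟩, hx⟩ := hz i a w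
    rw [hx]; exact ht
  · intro h
    exact ⟨PUnit.unit, fun i a w => ⟨fun _ => x i a w, ⟨x i a w, h i a w, rfl⟩, rfl⟩⟩

/-- In the region signature Joshi's tensor locus `Θ̃^𝓘_Mochizuki` IS `∏ Rgn`. [folklore] -/
theorem thetaLocusTensorM_regionLoci : (regionLoci S Rgn hne).thetaLocusTensorM = regionTuples S Rgn := by
  ext t
  simp only [ATS3.TensorPacketLociDatum.thetaLocusTensorM, ATS3.TensorPacketLociDatum.thetaLocusProdM, mem_image]
  constructor
  · rintro ⟨x, hx, rfl⟩
    exact (mem_psiM_regionLoci S Rgn hne x).mp hx _ _ _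
  · intro ht
    exact ⟨fun _ _ _ => t, (mem_psiM_regionLoci S Rgn hne _).mpr fun _ _ _ => ht, rfl⟩

variable {P : Cor312.Setting S.toSituation} (𝔇 : Dictionary S)

/-- **The coordinate reading** of the region signature (row D-09 = the `(j, v_ℚ)`-coordinate; row D-02 = everything is the
standard point). [folklore] -/
def regionReading : LociReading P (regionLoci S Rgn hne) 𝔇 where
  proj := fun j vQ t => t.ofTopology j vQ
  pt := fun _ => 𝔇.std
  pt_zTheta := rfl

/-- **Joshi's locus, read back through the coordinates, IS the prescribed region family.** [folklore] -/
theorem locusRegion_regionReading (j : T.Label) (vQ : T.VQ) :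
    (regionReading S Rgn hne 𝔇 (P := P)).locusRegion j vQ = Rgn j vQ := by
  classical
  rw [LociReading.locusRegion, thetaLocusTensorM_regionLoci]
  refine Subset.antisymm ?_ fun r hr => ?_
  · rintro _ ⟨t, ht, rfl⟩; exact ht j vQ
  · let c : ∀ (j : T.Label) (vQ : T.VQ), S.L.Packet j vQ := fun j vQ => (hne j vQ).some
    refine ⟨WithTopology.toTopology ⊤ (Function.update c j (Function.update (c j) vQ r)), fun j' vQ' => ?_, by simp [regionReading]⟩
    show Function.update c j (Function.update (c j) vQ r) j' vQ' ∈ Rgn j' vQ'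
    by_cases hj : j' = j
    · subst hj
      rw [Function.update_self]
      by_cases hv : vQ' = vQ
      · subst hv; rw [Function.update_self]; exact hr
      · rw [Function.update_of_ne hv]; exact (hne _ _).some_mem
    · rw [Function.update_of_ne hj]; exact (hne _ _).some_mem

/-- Signature row (7) «`Θ̃^{Ĩ}_J ⊂ Ĩ_J`» holds (the shell is everything). [folklore] -/
theorem regionLoci_locusInShellsJ : (regionLoci S Rgn hne).LocusInShellsJ := fun _ _ =>
  mem_univ_pi.mpr fun _ => mem_univ_pi.mpr fun _ => mem_univ _

/-- Signature row (7) «`Θ̃^{Ĩ}_M ⊂ Ĩ_M`» holds. [folklore] -/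
theorem regionLoci_locusInShellsM : (regionLoci S Rgn hne).LocusInShellsM := fun _ _ =>
  mem_univ_pi.mpr fun _ => mem_univ_pi.mpr fun _ => mem_univ_pi.mpr fun _ => mem_univ _

/-- The collation maps are injective (from a one-point carrier) — but NOT onto the shell (`CollOntoShell` is not modelled: the toy
does not carry Prop. 9.7.2.3). [folklore] -/
theorem regionLoci_collInjective : (regionLoci S Rgn hne).CollInjective := fun _ _ _ _ _ _ _ => rfl

/-! ## 2. Rows for the datum reading `Rgn := ρ (𝔇.datum 𝔇.std)` -/

variable (ρ : (∀ v : T.V, v ∈ T.Vbad → Set (S.L.StarPacket v)) → ∀ (j : T.Label) (vQ : T.VQ), Set (S.L.Packet j vQ))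
  (hneD : ∀ (j : T.Label) (vQ : T.VQ), (ρ (𝔇.datum 𝔇.std) j vQ).Nonempty)

/-- OUR READING `StdDatumWithinLocus` holds (with equality) for the datum regions. [folklore] -/
theorem datum_stdDatumWithinLocus : (regionReading S _ hneD 𝔇 (P := P)).StdDatumWithinLocus ρ := fun j vQ =>
  (locusRegion_regionReading S _ hneD 𝔇 j vQ).symm.subset

/-- OUR READING `GeneratorsReadAsData` holds for the datum regions (every Ansatz point is read as the standard one). [folklore] -/
theorem datum_generatorsReadAsData : (regionReading S _ hneD 𝔇 (P := P)).GeneratorsReadAsData ρ := fun z j vQ => by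
  refine ((regionReading S _ hneD 𝔇).generatorRegion_subset_locusRegion z j vQ).trans ?_
  rw [locusRegion_regionReading, show (regionReading S _ hneD 𝔇 (P := P)).pt z = 𝔇.std from rfl]

/-- `LocusWithinPossibleImages` holds as soon as the datum regions lie in the (Ind3)-enlarged Θ-region. [folklore] -/
theorem datum_locusWithinPossibleImages (h : ∀ (j : T.Label) (vQ : T.VQ), ρ (𝔇.datum 𝔇.std) j vQ ⊆ P.thetaRegion3 j vQ) :
    (regionReading S _ hneD 𝔇 (P := P)).LocusWithinPossibleImages := fun j vQ => by
  rw [locusRegion_regionReading]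
  exact (h j vQ).trans (subset_sUnion_of_mem (P.thetaRegion3_mem_possibleImages j vQ))

/-- `PossibleImagesWithinLocus` holds as soon as every possible image lies in the datum regions. [folklore] -/
theorem datum_possibleImagesWithinLocus (h : ∀ (j : T.Label) (vQ : T.VQ), ⋃₀ P.possibleImages j vQ ⊆ ρ (𝔇.datum 𝔇.std) j vQ) :
    (regionReading S _ hneD 𝔇 (P := P)).PossibleImagesWithinLocus := fun j vQ => by
  rw [locusRegion_regionReading]; exact h j vQ

end Region

/-! ## 3. THE FLOOR MODEL (p429619's `linkIdSetting p = expSetting p (1,4)`, Θ-reading): all rows + S hold — DEGENERATE -/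

section Floor

open Cor312Vol.NaiveWitness Cor312Vol.GluedMonoids.Naive

variable (p : ℕ) [hp : Fact p.Prime]

/-- At the floor the standard datum's regions `ρ Ψ_n` are the (Ind3)-enlarged Θ-regions. [folklore] -/
theorem floor_datum_eq_thetaRegion3 (j : Cor312.Checks.toyIndex.Label) (vQ : Cor312.Checks.toyIndex.VQ) :
    ballOfMonoid p ((floorDictionary p).datum (floorDictionary p).std) j vQ = (expSetting p expSq).thetaRegion3 j vQ :=
  (Cor312Vol.thetaRegion3_eq_of_thetaPinned (naiveFull p).toLatticeSituation (expSetting p expSq) (ballOfMonoid p)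
    (naive_kummerB p _) (expSetting_pinnedRegions p expSq).1 j vQ).symm

/-- … hence non-empty (they are the balls `B_{j²}`). [folklore] -/
theorem floor_datum_nonempty (j : Cor312.Checks.toyIndex.Label) (vQ : Cor312.Checks.toyIndex.VQ) :
    (ballOfMonoid p ((floorDictionary p).datum (floorDictionary p).std) j vQ).Nonempty := by
  rw [floor_datum_eq_thetaRegion3,
    Cor312Vol.thetaRegion3_eq_of_thetaPinned (naiveFull p).toLatticeSituation (expSetting p expSq) (ballOfMonoid p)
      (naive_kummerB p _) (expSetting_pinnedRegions p expSq).1 j vQ]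
  show (ballOfMonoid p (fun v _ => Psi p v) j vQ).Nonempty
  rw [ballOfMonoid_psi]
  exact ⟨0, zero_mem_pBall p j vQ _⟩

/-- The floor loci signature and its reading (toy DATA). [folklore] -/
abbrev floorLoci := regionLoci (naiveFull p).toLatticeSituation _ (floor_datum_nonempty p)

/-- The floor reading over `linkIdSetting p = expSetting p (1,4)`. [folklore] -/
abbrev floorReading : LociReading (expSetting p expSq) (floorLoci p) (floorDictionary p) :=
  regionReading (naiveFull p).toLatticeSituation _ (floor_datum_nonempty p) (floorDictionary p)

/-- **X-09, FLOOR: the D-11 chain is SATISFIABLE (DEGENERATE model).** At `linkIdSetting p` with `ρ = ballOfMonoid p`, `qK = Ψ`: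
`LocusWithinPossibleImages ∧ LocusWithinHull ∧ StdDatumWithinLocus ∧ GeneratorsReadAsData ∧ LocusInShellsJ ∧ LocusInShellsM` for the
Θ-reading of Joshi's locus, TOGETHER WITH Y₁, Y₂ (R15: STRONGER-THAN-PRINT), S = `PilotKummerIndRelated`, the three pins, `BridgeHyps`
and the typed Corollary 3.12 (all from p429619). Degeneracy as in X-04-min: one point, no moves, `LogvolInvariant`, Θ := q collapse.
[claim: Joshi2024ATS3, status: disputed] -/
theorem floor_loci_model :
    (floorReading p).LocusWithinPossibleImages ∧ (floorReading p).LocusWithinHull ∧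
      (floorReading p).StdDatumWithinLocus (ballOfMonoid p) ∧ (floorReading p).GeneratorsReadAsData (ballOfMonoid p) ∧
      (floorLoci p).LocusInShellsJ ∧ (floorLoci p).LocusInShellsM ∧
      AnsatzWithinInd (ballOfMonoid p) (floorDictionary p) (P := expSetting p expSq) ∧
      StandardPointIsQPilot (ballOfMonoid p) (fun v _ => qDatumExp p expSq v) (floorDictionary p) ∧
      PilotKummerIndRelated (naiveFull p).toLatticeSituation (expSetting p expSq) (ballOfMonoid p) (fun v _ => qDatumExp p expSq v) ∧
      (expSetting p expSq).Statement := by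
  have hPI : (floorReading p).LocusWithinPossibleImages :=
    datum_locusWithinPossibleImages _ (floorDictionary p) (ballOfMonoid p) (floor_datum_nonempty p)
      fun j vQ => (floor_datum_eq_thetaRegion3 p j vQ).subset
  exact ⟨hPI, (floorReading p).locusWithinHull_of_locusWithinPossibleImages hPI,
    datum_stdDatumWithinLocus _ (floorDictionary p) (ballOfMonoid p) (floor_datum_nonempty p),
    datum_generatorsReadAsData _ (floorDictionary p) (ballOfMonoid p) (floor_datum_nonempty p),
    regionLoci_locusInShellsJ _ _ _, regionLoci_locusInShellsM _ _ _,
    floor_ansatzWithinInd p, floor_standardPointIsQPilot p, floor_pilotKummerIndRelated p, (floor_statement_attained p).1⟩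

/-- FLOOR: the hull-level chain of p429683 RUNS (its conclusion, the (xi-f) licence, obtained from the loci rows + Y₂ + the q-pin).
[claim: Joshi2024ATS3, status: disputed] -/
theorem floor_licence_via_loci : Thm311ToCor312.Licence (expSetting p expSq) :=
  (floorReading p).licence_of_locusWithinHull (ballOfMonoid p) (fun v _ => qDatumExp p expSq v) (floor_loci_model p).2.1
    (floor_loci_model p).2.2.1 (floor_standardPointIsQPilot p) (expSetting_pinnedRegions p expSq).2

/-- FLOOR: the second half of print's «are» — the possible images are the single ball `B_{j²}` (naive (Ind1)/(Ind2) act by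
isometries, `NaiveWitness.possibleImages_eq_of_thetaPinned`) = the Θ-datum region = the locus read. [claim: Joshi2024ATS3, status: disputed] -/
theorem floor_possibleImagesWithinLocus : (floorReading p).PossibleImagesWithinLocus := by
  refine datum_possibleImagesWithinLocus _ (floorDictionary p) (ballOfMonoid p) (floor_datum_nonempty p) fun j vQ => ?_
  rw [NaiveWitness.possibleImages_eq_of_thetaPinned p (expSetting p expSq) (expSetting_pinnedRegions p expSq).1 j vQ,
    sUnion_singleton, floor_datum_eq_thetaRegion3,
    NaiveWitness.thetaRegion3_eq_of_thetaPinned p (expSetting p expSq) (expSetting_pinnedRegions p expSq).1 j vQ]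
end Floor

/-! ## 4. THE PINNED COUNTERMODEL (p419720, S false): the split -/

section Pinned

open Cor312Vol.PinnedWitness Cor312Vol.NaiveWitness Cor312Vol.GluedMonoids.Naive

variable (p : ℕ) [hp : Fact p.Prime]

/-- Θ-reading at the pinned countermodel: the move-free dictionary with datum `Ψ_n`. [folklore] -/
abbrev pinnedThetaDictionary : Dictionary (naiveFull p).toLatticeSituation :=
  constDictionary (naiveFull p).toLatticeSituation ((naiveFull p).D (pinnedSetting p).n).Ψ

/-- q-reading at the pinned countermodel: the move-free dictionary with datum `qK` («Joshi's data = the q-tuple»). [folklore] -/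
abbrev pinnedQDictionary : Dictionary (naiveFull p).toLatticeSituation :=
  constDictionary (naiveFull p).toLatticeSituation (PinnedWitness.qDatum p)

/-- The Θ-datum's regions are the balls `B_{j²}` = the (Ind3)-enlarged Θ-regions. [folklore] -/
theorem pinned_thetaDatum_eq (j : Cor312.Checks.toyIndex.Label) (vQ : Cor312.Checks.toyIndex.VQ) :
    orbitRegion p ((pinnedThetaDictionary p).datum (pinnedThetaDictionary p).std) j vQ = (pinnedSetting p).thetaRegion3 j vQ :=
  (Cor312Vol.thetaRegion3_eq_of_thetaPinned (naiveFull p).toLatticeSituation (pinnedSetting p) (orbitRegion p)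
    (naive_kummerB p _) (pinnedSetting_pinnedRegions p).1 j vQ).symm

/-- … hence non-empty. [folklore] -/
theorem pinned_thetaDatum_nonempty (j : Cor312.Checks.toyIndex.Label) (vQ : Cor312.Checks.toyIndex.VQ) :
    (orbitRegion p ((pinnedThetaDictionary p).datum (pinnedThetaDictionary p).std) j vQ).Nonempty := by
  rw [pinned_thetaDatum_eq, pinnedSetting_thetaRegion3]
  exact ⟨0, zero_mem_pBall p j vQ _⟩

/-- The q-datum's regions are the q-pilot's regions (q-pin). [folklore] -/
theorem pinned_qDatum_eq (j : Cor312.Checks.toyIndex.Label) (vQ : Cor312.Checks.toyIndex.VQ) :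
    orbitRegion p ((pinnedQDictionary p).datum (pinnedQDictionary p).std) j vQ = (pinnedSetting p).qRegion j vQ :=
  ((pinnedSetting_pinnedRegions p).2 j vQ).symm

/-- … hence non-empty (a hull-set). [folklore] -/
theorem pinned_qDatum_nonempty (j : Cor312.Checks.toyIndex.Label) (vQ : Cor312.Checks.toyIndex.VQ) :
    (orbitRegion p ((pinnedQDictionary p).datum (pinnedQDictionary p).std) j vQ).Nonempty := by
  rw [pinned_qDatum_eq]
  exact (pinnedSetting_bridgeHyps p).hul_nonempty j vQ _ ((pinnedSetting p).qRegion_mem j vQ)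

/-- The Θ-reading loci signature at the pinned countermodel (toy DATA). [folklore] -/
abbrev pinnedThetaLoci := regionLoci (naiveFull p).toLatticeSituation _ (pinned_thetaDatum_nonempty p)

/-- The q-reading loci signature at the pinned countermodel (toy DATA). [folklore] -/
abbrev pinnedQLoci := regionLoci (naiveFull p).toLatticeSituation _ (pinned_qDatum_nonempty p)

/-- The Θ-reading of Joshi's locus at the pinned countermodel (toy DATA). [folklore] -/
abbrev pinnedThetaReading : LociReading (pinnedSetting p) (pinnedThetaLoci p) (pinnedThetaDictionary p) :=
  regionReading (naiveFull p).toLatticeSituation _ (pinned_thetaDatum_nonempty p) (pinnedThetaDictionary p)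

/-- The q-reading of Joshi's locus at the pinned countermodel (toy DATA). [folklore] -/
abbrev pinnedQReading : LociReading (pinnedSetting p) (pinnedQLoci p) (pinnedQDictionary p) :=
  regionReading (naiveFull p).toLatticeSituation _ (pinned_qDatum_nonempty p) (pinnedQDictionary p)

/-- **X-09, PINNED, Θ-reading: every loci row holds — BOTH halves of print's «are» (the possible images at the pinned model are the
single ball `B_{j²}`), the hull row, both concordance readings — while Y₂ `StandardPointIsQPilot` FAILS** (S fails there). J-FALSE-AT-PINNED
data for the identification, not for the loci rows. [claim: Joshi2024ATS3, status: disputed] -/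
theorem pinned_theta_split :
    (pinnedThetaReading p).LocusWithinPossibleImages ∧ (pinnedThetaReading p).PossibleImagesWithinLocus ∧
      (pinnedThetaReading p).LocusWithinHull ∧ (pinnedThetaReading p).StdDatumWithinLocus (orbitRegion p) ∧
      (pinnedThetaReading p).GeneratorsReadAsData (orbitRegion p) ∧
      ¬ StandardPointIsQPilot (orbitRegion p) (PinnedWitness.qDatum p) (pinnedThetaDictionary p) := by
  have hPI : (pinnedThetaReading p).LocusWithinPossibleImages :=
    datum_locusWithinPossibleImages _ (pinnedThetaDictionary p) (orbitRegion p) (pinned_thetaDatum_nonempty p)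
      fun j vQ => (pinned_thetaDatum_eq p j vQ).subset
  refine ⟨hPI, ?_, (pinnedThetaReading p).locusWithinHull_of_locusWithinPossibleImages hPI,
    datum_stdDatumWithinLocus _ (pinnedThetaDictionary p) (orbitRegion p) (pinned_thetaDatum_nonempty p),
    datum_generatorsReadAsData _ (pinnedThetaDictionary p) (orbitRegion p) (pinned_thetaDatum_nonempty p),
    const_theta_not_standardPointIsQPilot _ _ _ _ (pinnedSetting_not_pilotKummerIndRelated p)⟩
  refine datum_possibleImagesWithinLocus _ (pinnedThetaDictionary p) (orbitRegion p) (pinned_thetaDatum_nonempty p) fun j vQ => ?_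
  rw [pinnedSetting_possibleImages, sUnion_singleton, pinned_thetaDatum_eq, pinnedSetting_thetaRegion3]

/-- **X-09, PINNED, q-reading: `StdDatumWithinLocus ∧ StandardPointIsQPilot ∧ GeneratorsReadAsData` hold while `LocusWithinHull` —
hence `LocusWithinPossibleImages` — FAILS** (p430545's universal J-FALSE-AT-PINNED form, instantiated: the locus carries the q-pilot,
so it cannot sit inside `^{n,∘}𝒰` where the licence fails). [claim: Joshi2024ATS3, status: disputed] -/
theorem pinned_q_split :
    (pinnedQReading p).StdDatumWithinLocus (orbitRegion p) ∧ StandardPointIsQPilot (orbitRegion p) (PinnedWitness.qDatum p) (pinnedQDictionary p) ∧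
      (pinnedQReading p).GeneratorsReadAsData (orbitRegion p) ∧
      ¬ (pinnedQReading p).LocusWithinHull ∧ ¬ (pinnedQReading p).LocusWithinPossibleImages := by
  have hstd : (pinnedQReading p).StdDatumWithinLocus (orbitRegion p) :=
    datum_stdDatumWithinLocus _ (pinnedQDictionary p) (orbitRegion p) (pinned_qDatum_nonempty p)
  have hY2 : StandardPointIsQPilot (orbitRegion p) (PinnedWitness.qDatum p) (pinnedQDictionary p) := const_q_standardPointIsQPilot _ _ _
  exact ⟨hstd, hY2, datum_generatorsReadAsData _ (pinnedQDictionary p) (orbitRegion p) (pinned_qDatum_nonempty p),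
    not_locusWithinHull_pinned p (orbitRegion p) (PinnedWitness.qDatum p) (pinnedQReading p) hstd hY2 (pinnedSetting_pinnedRegions p).2,
    not_locusWithinPossibleImages_pinned p (orbitRegion p) (PinnedWitness.qDatum p) (pinnedQReading p) hstd hY2 (pinnedSetting_pinnedRegions p).2⟩

/-- **X-09 summary at the model of record:** no reading of Joshi's locus at the pinned countermodel has the loci row `LocusWithinHull`,
the concordance `StdDatumWithinLocus` AND the identification Y₂ together (p430545) — and each proper subset of the three IS realised
(Θ-reading: rows + concordance, ¬Y₂; q-reading: concordance + Y₂, ¬row). LOCATED along «standard datum = q-pilot datum»; no side taken.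
[claim: Joshi2024ATS3, status: disputed] -/
theorem pinned_loci_located :
    ((pinnedThetaReading p).LocusWithinHull ∧ (pinnedThetaReading p).StdDatumWithinLocus (orbitRegion p) ∧
        ¬ StandardPointIsQPilot (orbitRegion p) (PinnedWitness.qDatum p) (pinnedThetaDictionary p)) ∧
      ((pinnedQReading p).StdDatumWithinLocus (orbitRegion p) ∧
        StandardPointIsQPilot (orbitRegion p) (PinnedWitness.qDatum p) (pinnedQDictionary p) ∧ ¬ (pinnedQReading p).LocusWithinHull) :=
  ⟨⟨(pinned_theta_split p).2.2.1, (pinned_theta_split p).2.2.2.1, (pinned_theta_split p).2.2.2.2.2⟩,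
    ⟨(pinned_q_split p).1, (pinned_q_split p).2.1, (pinned_q_split p).2.2.2.1⟩⟩

end Pinned

end Summit.ABC.IUTFork.Joshi

end
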